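import Summits.QuantumFields.YangMills.Theorems.PoincareLipschitzSphereMapBandSuppliers
import Summits.QuantumFields.YangMills.Theorems.PoincareLipschitzSphereMapPoincareL1

/-!
# Line «poincare_lipschitz» on crux `HistoryTailL` (stmt-QuantumFields-19936), route crux `BlockLipschitzL` (stmt-QuantumFields-23533), K2 organ of record LOC-REG-MIN —
# FLAT SHADOW «ENERGY → RANGE» (E→R) FOR LATTICE MINIMISERS INTO A SPHERE, FILE 5d-F3a (d = 3): THE NEAR-SPHERE SUPPLIERS OF ✓`oneStep_tent` FROM THE DYADIC BANDS —
# if every band `Q_{r′−2^k}(z) ∖ Q_{r′−2^{k+2}}(z)`, `k ≤ n`, carries energy `≤ G·2^k`, then OFF `Q_{R−1}(z)` (`R = r′ − 2^n`) the tent-mollified unit field satisfies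
# `‖c y‖ ≥ 1 − 2√(6G)`, and `E_U ≤ 2^{n+1}·G`

Cell `ym3-torus` (YM ladder rung R3 = continuum SU(2) Yang–Mills on the three-torus — a RUNG, NOT the Clay problem: not d = 4, not infinite volume, not a mass gap); width seat
`ym-ust-19936-w5` gen 12 (LEAD ym-ust-19936-w1 g8 2026-08-29T05:29:02Z END-GAME «[C] = E→R F5 (★w5) + F6 (px8)»; my LOCATE `E2R-ROAD-w5g12.md` §2 (iii)).  THEOREMS ONLY
(def-free), `d = 3`, values in any real inner-product space; uses ★w5 g12's ✓F2b `one_sub_norm_boxMean_le_sqrt`, ✓F5d-F2 `sum_box_outerRadius_le`∕`sum_U_le_sum_bands`, ✓F5d-D tent letters;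
`--supports stmt-QuantumFields-19936`.  Nothing here proves px8's `hone`, E→R, LOC-REG-MIN, `hReg`, `hImprove`, a stub, `BlockLipschitzL`, `HistoryTailL` or a summit statement.
* §1 `tent_eq_outer_of_le` (on `‖y−z‖_∞ ≥ R` the tent radius with `R_in = 2R − r′` is the outer radius `⌊(r′ − ‖y−z‖_∞)₊∕4⌋`);
* §2 ★★★ `norm_tentMollifier_ge_of_bands` — `‖c y‖ ≥ 1 − 2√(6G)` for every `y ∉ Q_{R−1}(z)` (radius `0`: `c = u`; radius `≥ 1`: the box sits in one band, ✓F2b);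
* §3 ★ `energy_U_le_of_bands` — `E(u; Q_{r′−1} ∖ Q_{r′−2^{n+1}}) ≤ 2^{n+1}·G`.
[folklore] ([SchoenUhlenbeck1982] §4; the lattice statements are this file's).
-/

set_option autoImplicit false

noncomputable section

open scoped BigOperators
open Finset

namespace Summit.QuantumFields.YangMills.Theorems.PoincareLipschitzSphereMapNearSphereFromBands

open Literature.MathematicalPhysics.QuantumFieldTheory.Balaban1983to89
open B4Eq19LatticeOperators
open Summit.QuantumFields.YangMills.Theorems.PoincareLipschitzSphereMapDepthRadius (mem_box_iff_sup_le mean_box_zero)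
open Summit.QuantumFields.YangMills.Theorems.PoincareLipschitzSphereMapBandSuppliers (sum_box_outerRadius_le sum_U_le_sum_bands)
open Summit.QuantumFields.YangMills.Theorems.PoincareLipschitzSphereMapPoincareL1 (one_sub_norm_boxMean_le_sqrt)

variable {V : Type*} [NormedAddCommGroup V] [InnerProductSpace ℝ V]

/-! ## §1 On the outer slope the tent is the outer radius -/

/-- For `‖y − z‖_∞ ≥ R` the tent radius with `R_in = 2R − r′` equals `⌊(r′ − ‖y−z‖_∞)₊∕4⌋`. [folklore] -/
theorem tent_eq_outer_of_le {d : ℕ} (z : Zd d) (r' R : ℤ) (y : Zd d) (hy : R ≤ ((Finset.univ.sup fun j => (y j - z j).natAbs : ℕ) : ℤ)) :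
    (((min (r' - ((Finset.univ.sup fun j => (y j - z j).natAbs : ℕ) : ℤ)) (((Finset.univ.sup fun j => (y j - z j).natAbs : ℕ) : ℤ) - (2 * R - r'))).toNat / 4 : ℕ) : ℤ) =
      (((r' - ((Finset.univ.sup fun j => (y j - z j).natAbs : ℕ) : ℤ)).toNat / 4 : ℕ) : ℤ) := by
  rw [min_eq_left (by linarith)]

/-! ## §2 The tent mollifier is near the sphere off `Q_{R−1}(z)` -/

/-- ★★★ **NEAR-SPHERE OFF THE INTERIOR, FROM THE BANDS** (`d = 3`): `u` unit-valued; `R = r′ − 2^n`; every band `Q_{r′−2^k}(z) ∖ Q_{r′−2^{k+2}}(z)` with `k ≤ n` carries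
`Σ Σ_μ ‖u(w+e_μ) − u w‖² ≤ G·2^k`; `c` the tent-mollified field (`R_in = 2R − r′`).  THEN for every `y ∉ Q_{R−1}(z)`: `1 − 2√(6G) ≤ ‖c y‖`. [folklore]
[cite: SchoenUhlenbeck1982, §4] -/
theorem norm_tentMollifier_ge_of_bands (u c : Zd 3 → V) (z : Zd 3) {r' R : ℤ} {n : ℕ} (hR : R = r' - (2 : ℤ) ^ n)
    (hu : ∀ y, ‖u y‖ = 1)
    (hc : ∀ y, c y = (((box y ((((min (r' - ((Finset.univ.sup fun j => (y j - z j).natAbs : ℕ) : ℤ))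
        (((Finset.univ.sup fun j => (y j - z j).natAbs : ℕ) : ℤ) - (2 * R - r'))).toNat / 4 : ℕ) : ℤ))).card : ℝ))⁻¹ •
      ∑ w ∈ box y ((((min (r' - ((Finset.univ.sup fun j => (y j - z j).natAbs : ℕ) : ℤ))
        (((Finset.univ.sup fun j => (y j - z j).natAbs : ℕ) : ℤ) - (2 * R - r'))).toNat / 4 : ℕ) : ℤ)), u w)
    {G : ℝ} (hG : 0 ≤ G)
    (hgood : ∀ k ≤ n, ∑ w ∈ box z (r' - (2 : ℤ) ^ k) \ box z (r' - (2 : ℤ) ^ (k + 2)), ∑ μ, ‖u (w + unitVec μ) - u w‖ ^ 2 ≤ G * (2 : ℝ) ^ k)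
    {y : Zd 3} (hy : y ∉ box z (R - 1)) :
    1 - 2 * Real.sqrt (6 * G) ≤ ‖c y‖ := by
  have hd : 0 < 3 := by norm_num
  set D : ℤ := ((Finset.univ.sup fun j => (y j - z j).natAbs : ℕ) : ℤ) with hD
  have hDR : R ≤ D := by
    have : ¬ D ≤ R - 1 := fun h => hy ((mem_box_iff_sup_le hd y z (R - 1)).2 h)
    omega
  -- the radius at `y` is the outer radius `s' = ⌊(r' − D)₊/4⌋`
  have hrad := tent_eq_outer_of_le z r' R y hDR
  set s' : ℕ := (r' - D).toNat / 4 with hs'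
  have hcy : c y = (((box y (s' : ℤ)).card : ℝ))⁻¹ • ∑ w ∈ box y (s' : ℤ), u w := by rw [hc y, hrad]
  have hsq0 : 0 ≤ 2 * Real.sqrt (6 * G) := by positivity
  by_cases ht : r' - D < 4
  · -- radius zero: `c y = u y`
    have hs0 : s' = 0 := by rw [hs']; apply Nat.div_eq_of_lt; omega
    rw [hcy, hs0]; push_cast; rw [mean_box_zero u y, hu y]; linarith
  · push Not at ht
    -- the mollifier box sits in one band
    obtain ⟨k, hEk, h2k, hkt⟩ := sum_box_outerRadius_le hd z r' y ht (fun w => ∑ μ, ‖u (w + unitVec μ) - u w‖ ^ 2)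
      (fun w => Finset.sum_nonneg fun _ _ => by positivity)
    -- `k ≤ n` since `2^k < r' − D ≤ 2^n`
    have hkn : k ≤ n := by
      have hh : r' - D ≤ (2 : ℤ) ^ n := by linarith
      have h1 : ((2 ^ k : ℕ) : ℤ) < (2 : ℤ) ^ n := lt_of_lt_of_le hkt hh
      have h2 : (2 : ℤ) ^ n = ((2 ^ n : ℕ) : ℤ) := by push_cast; ring
      rw [h2] at h1
      have h3 : 2 ^ k < 2 ^ n := by exact_mod_cast h1
      exact ((Nat.pow_lt_pow_iff_right (by norm_num : 1 < 2)).1 h3).le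
    have hband := hgood k hkn
    -- energy of the mollifier box: `≤ G·2^k ≤ 2G(2s'+1)`
    set a : ℝ := ((2 * (s' : ℤ) + 1 : ℤ) : ℝ) with ha
    have ha0 : 0 < a := by rw [ha]; exact_mod_cast (show (0:ℤ) < 2 * (s' : ℤ) + 1 by omega)
    have h2k' : (2 : ℝ) ^ k ≤ 2 * a := by
      have e : (2 : ℝ) ^ k = (((2 ^ k : ℕ) : ℤ) : ℝ) := by push_cast; ring
      rw [e, ha]; exact_mod_cast h2k
    have hE : ∑ w ∈ box y (s' : ℤ), ∑ μ, ‖u (w + unitVec μ) - u w‖ ^ 2 ≤ 2 * G * a := by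
      have := hEk.trans hband
      calc _ ≤ G * (2 : ℝ) ^ k := this
        _ ≤ G * (2 * a) := mul_le_mul_of_nonneg_left h2k' hG
        _ = 2 * G * a := by ring
    -- F2b at radius `s'`
    have hs'0 : (0 : ℤ) ≤ (s' : ℤ) := by exact_mod_cast Nat.zero_le _
    have hF := one_sub_norm_boxMean_le_sqrt u y hs'0 (fun w _ => hu w)
    have hcard : (((box y (s' : ℤ)).card : ℝ)) = a ^ 3 := by rw [card_box y hs'0, ha]
    rw [← ha] at hF
    rw [hcy]
    -- `2a·√(3·(#Q)⁻¹·E) ≤ 2a·√(6G∕a²) = 2√(6G)`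
    have h1 : (3 : ℝ) * (((box y (s' : ℤ)).card : ℝ))⁻¹ * ∑ w ∈ box y (s' : ℤ), ∑ μ, ‖u (w + unitVec μ) - u w‖ ^ 2 ≤ 6 * G / a ^ 2 := by
      rw [hcard]
      have hc3 : 0 ≤ (3 : ℝ) * (a ^ 3)⁻¹ := by positivity
      calc (3 : ℝ) * (a ^ 3)⁻¹ * ∑ w ∈ box y (s' : ℤ), ∑ μ, ‖u (w + unitVec μ) - u w‖ ^ 2 ≤ 3 * (a ^ 3)⁻¹ * (2 * G * a) :=
            mul_le_mul_of_nonneg_left hE hc3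
        _ = 6 * G / a ^ 2 := by field_simp; ring
    have h2 : Real.sqrt ((3 : ℕ) * (((box y (s' : ℤ)).card : ℝ))⁻¹ * ∑ w ∈ box y (s' : ℤ), ∑ μ, ‖u (w + unitVec μ) - u w‖ ^ 2) ≤ Real.sqrt (6 * G) / a := by
      have e : ((3 : ℕ) : ℝ) = 3 := by norm_num
      rw [e]
      calc _ ≤ Real.sqrt (6 * G / a ^ 2) := Real.sqrt_le_sqrt h1
        _ = Real.sqrt (6 * G) / a := by rw [Real.sqrt_div (by positivity), Real.sqrt_sq ha0.le]
    have h3 : 2 * a * Real.sqrt ((3 : ℕ) * (((box y (s' : ℤ)).card : ℝ))⁻¹ * ∑ w ∈ box y (s' : ℤ), ∑ μ, ‖u (w + unitVec μ) - u w‖ ^ 2) ≤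
        2 * Real.sqrt (6 * G) := by
      calc _ ≤ 2 * a * (Real.sqrt (6 * G) / a) := mul_le_mul_of_nonneg_left h2 (by positivity)
        _ = 2 * Real.sqrt (6 * G) := by field_simp
    linarith

/-! ## §3 The band energy `E_U` -/

omit [InnerProductSpace ℝ V] in
/-- ★ **`E_U ≤ 2^{n+1}·G`**: if every band `k ≤ n` carries `≤ G·2^k`, then `E(u; Q_{r′−1}(z) ∖ Q_{r′−2^{n+1}}(z)) ≤ 2^{n+1}·G` (band cover ✓`sum_U_le_sum_bands` + geometric
sum). [folklore] -/
theorem energy_U_le_of_bands (u : Zd 3 → V) (z : Zd 3) (r' : ℤ) (n : ℕ) {G : ℝ} (hG : 0 ≤ G)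
    (hgood : ∀ k ≤ n, ∑ w ∈ box z (r' - (2 : ℤ) ^ k) \ box z (r' - (2 : ℤ) ^ (k + 2)), ∑ μ, ‖u (w + unitVec μ) - u w‖ ^ 2 ≤ G * (2 : ℝ) ^ k) :
    ∑ w ∈ box z (r' - 1) \ box z (r' - (2 : ℤ) ^ (n + 1)), ∑ μ, ‖u (w + unitVec μ) - u w‖ ^ 2 ≤ (2 : ℝ) ^ (n + 1) * G := by
  have hd : 0 < 3 := by norm_num
  have h1 := sum_U_le_sum_bands hd z r' n (fun w => ∑ μ, ‖u (w + unitVec μ) - u w‖ ^ 2) (fun w => Finset.sum_nonneg fun _ _ => by positivity)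
  have h2 : ∑ k ∈ Finset.range (n + 1), ∑ w ∈ box z (r' - (2 : ℤ) ^ k) \ box z (r' - (2 : ℤ) ^ (k + 2)), ∑ μ, ‖u (w + unitVec μ) - u w‖ ^ 2 ≤
      ∑ k ∈ Finset.range (n + 1), G * (2 : ℝ) ^ k :=
    Finset.sum_le_sum fun k hk => hgood k (by rw [Finset.mem_range] at hk; omega)
  have h3 : ∑ k ∈ Finset.range (n + 1), G * (2 : ℝ) ^ k ≤ (2 : ℝ) ^ (n + 1) * G := by
    rw [← Finset.mul_sum, geom_sum_eq (by norm_num : (2 : ℝ) ≠ 1) (n + 1)]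
    have : ((2 : ℝ) ^ (n + 1) - 1) / (2 - 1) ≤ (2 : ℝ) ^ (n + 1) := by norm_num
    nlinarith
  linarith

end Summit.QuantumFields.YangMills.Theorems.PoincareLipschitzSphereMapNearSphereFromBands
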